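import Summits.SmoothPoincare4.SmoothPoincare4.Theorems.SymplecticOrigamiGromovRecognitionRelEndHelperProductNbhd
import Summits.SmoothPoincare4.SmoothPoincare4.Theorems.SymplecticOrigamiGromovRecognitionRelEndHelperCommonRegularValue
import Summits.SmoothPoincare4.SmoothPoincare4.Theorems.SymplecticOrigamiGromovRecognitionRelEndHelperCrossingsFinite
import Summits.SmoothPoincare4.SmoothPoincare4.Theorems.SymplecticOrigamiGromovRecognitionRelEndHelperMoebiusTransitive
import Summits.SmoothPoincare4.SmoothPoincare4.Theorems.SymplecticOrigamiGromovRecognitionRelEndMoebiusHomotopic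
import Literature.Geometry.Symplectic.SphereIntersectionIndexHomologicalNoncompact

/-!
# The push-off sphere of a trivial-normal-bundle witness and its crossing data
(registered helper `helper_nwtKSide` of the stub `stub_normalWitnessTransfer`, line
`cross-cap-laurent`, crux `GromovRecognitionRelEnd`, item stmt-SmoothPoincare4-11009)

Setting: two embedded two-chart spheres `S = (u, v, F)` and `S₀ = (u₀, v₀, F₀)` in a Hausdorff
second countable smooth `4`-manifold `X` (`v z = u z⁻¹` off the origin, `F : ℂℙ¹ → X` the glued
map), with `F` homotopic to `F₀`, and a trivial normal bundle witness `(N, π)` of `S₀`: `N` open,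
`π : N → ℂ` a smooth submersion with `{π = 0} ∩ N = S₀ = range u₀ ∪ {v₀ 0}`.

Claim (`helper_nwtKSide`, pure packaging of landed helpers of the same line): there are
* the Ehresmann product neighbourhood `UK = ι (ℂℙ¹ × ℂ)` of `S₀` with its smooth submersion
  `g : UK → ℂ`, `g ∘ ι = pr₂` (`helper_productNbhd`; Th. Bröcker, K. Jänich, *Introduction to
  Differential Topology* (1982), (8.12));
* a small common regular value `s` of `g ∘ u`, `g ∘ v` with `s ≠ 0`, `s ≠ g (v 0)`
  (`helper_commonRegularValue` with the finite exceptional set `{0, g (v 0)}`; Sard–Brown,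
  J. Milnor, *Topology from the Differentiable Viewpoint* (1965), §§2–3), so that the compact
  push-off `K_s = {y ∈ UK | g y = s} = ι (ℂℙ¹ × {s})` misses `v 0`;
* finiteness of the crossing parameters `{z | u z ∈ K_s}` (`helper_crossingsFinite`) and the
  vanishing of the signed crossing count for all small radii (the argument of the landed
  `helper_homologicalCount`, run directly on the tree's
  `Literature.Geometry.Symplectic.sphere_zeroSetIndex_factorsThroughHomology_of_isClosed` for
  the normal coordinate `g - s` on `UK`, whose zero set `K_s` is closed: the counts are the values
  of an additive functional on `H₂(X; ℤ)` at `F_*[ℂℙ¹] = F₀_*[ℂℙ¹]` (homotopy invariance,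
  `F ≃ F₀`), and the value at `F₀_*[ℂℙ¹]` is an empty sum because the sphere
  `S₀ = ι (ℂℙ¹ × {0})` lies in the fibre `g = 0 ≠ s`; G. E. Bredon, *Topology and Geometry*
  (1993), VI.11 Thm. 11.9, IV.7 Cor. 7.5);
* a Möbius reparametrisation `G θ = ι (projectiveMap A θ, s)` of the push-off sphere whose
  "north pole" `G [0 : 1]` is not a crossing with `S`: the crossing set
  `{θ | ι (θ, s) ∈ range u ∪ {v 0}}` injects (by injectivity of `ι`) into the finite set of
  crossing parameters, `ℂℙ¹ ⊇ linePt 0 (ℂ)` is infinite, and Möbius transformations act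
  transitively (`helper_moebiusTransitive`); `G ≃ F` because `projectiveMap A ≃ id`
  (`helper_moebiusHomotopic`), `ι (·, s) ≃ ι (·, 0) = F₀` by the straight-line homotopy
  `(τ, θ) ↦ ι (θ, (1 - τ) • s)` in the `ℂ`-factor, and `F₀ ≃ F`.
No new definitions.
-/

noncomputable section

open scoped Manifold ContDiff Topology
open Set Function
open Literature.Topology.FourManifolds Literature.Topology.FourManifolds.ComplexProjectiveSpace
  Literature.Topology.FourManifolds.CodimTwoData Literature.Geometry.Symplectic
  Literature.Topology.PlaneTopology Literature.AlgebraicTopology.SingularHomology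

-- the prescribed namespace `Summit.<P>.<Sub>.…` duplicates `SmoothPoincare4` (P = Sub)
set_option linter.dupNamespace false

namespace Summit.SmoothPoincare4.SmoothPoincare4.Theorems.GromovRecognitionRelEnd.CrossCapLaurent

namespace HelperNwtKSide

/-- The Riemann sphere `ℂℙ¹` is infinite: the affine parametrisation `linePt 0 : ℂ → ℂℙ¹`,
`z ↦ [1 : z]`, is injective (its affine coordinate is `z`). [folklore] -/
theorem infinite_projectiveLine : Infinite (ComplexProjectiveSpace 1) :=
  @Infinite.of_injective _ _ (CharZero.infinite ℂ) (linePt 0) fun a b hab => by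
    rw [← affineCoordComplex_linePt 0 a, hab, affineCoordComplex_linePt]

/-- The fibre `{g = s}` over `U = range ι` of a product chart `ι : P × ℂ → X` with `g ∘ ι = pr₂`
is the push-off `θ ↦ ι (θ, s)` of the core `P × {0}`. [folklore] -/
theorem fibre_eq_range {X P : Type*} {U : Set X} {g : X → ℂ} {ι : P × ℂ → X}
    (hrange : range ι = U) (hg : ∀ q, g (ι q) = q.2) (s : ℂ) :
    {y | y ∈ U ∧ g y = s} = range fun θ => ι (θ, s) := by
  ext y
  constructor
  · rintro ⟨hyU, hys⟩
    rw [← hrange] at hyU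
    obtain ⟨⟨θ, t⟩, rfl⟩ := hyU
    rw [hg] at hys
    exact ⟨θ, by rw [← hys]⟩
  · rintro ⟨θ, rfl⟩
    exact ⟨hrange ▸ mem_range_self _, hg _⟩

/-- **The push-off `θ ↦ ι (θ, s)` is homotopic to the core `θ ↦ ι (θ, 0) = F₀ θ`** through the
straight-line homotopy `(τ, θ) ↦ ι (θ, (1 - τ) • s)` in the `ℂ`-factor. [folklore] -/
theorem homotopic_pushoff_core {X P : Type*} [TopologicalSpace X] [TopologicalSpace P]
    {ι : P × ℂ → X} (hι : Continuous ι) (s : ℂ) (ιS F₀ : C(P, X))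
    (hιS : ∀ θ, ιS θ = ι (θ, s)) (hF₀ : ∀ θ, ι (θ, 0) = F₀ θ) : ιS.Homotopic F₀ :=
  ⟨{ toFun := fun p => ι (p.2, (1 - (p.1 : ℝ)) • s)
     continuous_toFun := hι.comp (continuous_snd.prodMk
       ((continuous_const.sub (continuous_subtype_val.comp continuous_fst)).smul
         continuous_const))
     map_zero_left := fun θ => by simp [hιS]
     map_one_left := fun θ => by simp [hF₀] }⟩

end HelperNwtKSide

open HelperNwtKSide in
/-- **The push-off sphere of a trivial-normal-bundle witness and its crossing data.** For two
embedded two-chart spheres `(u, v, F)`, `(u₀, v₀, F₀)` in a smooth `4`-manifold with `F ≃ F₀`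
and a trivial normal bundle witness `(N, π)` of the second: the Ehresmann product neighbourhood
`UK = ι (ℂℙ¹ × ℂ)` with its submersion `g` (`g ∘ ι = pr₂`), a small nonzero common regular value
`s ≠ g (v 0)` of `g ∘ u`, `g ∘ v` (Sard–Brown), the compact push-off `K_s = {g = s}` with finitely
many `u`-crossings and vanishing signed crossing count (the count factors through `H₂` and
`(u₀, v₀)` lies in the fibre `g = 0`), and a Möbius reparametrisation
`G = ι (projectiveMap A ·, s) ≃ F` of the push-off sphere whose north pole `G [0 : 1]` is not a
crossing (the crossings of `K_s` with the first sphere are finite, `ℂℙ¹` is infinite, and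
`PGL₂(ℂ)` is transitive and connected).
[cite: BrockerJanichIDT1982, (8.12) (PDF pp. 57–58)] -/
theorem helper_nwtKSide : ∀ (X : Type) [TopologicalSpace X] [T2Space X] [SecondCountableTopology X] [ChartedSpace (EuclideanSpace ℝ (Fin 4)) X] [IsManifold (𝓡 4) ∞ X] (u v u₀ v₀ : ℂ → X) (N : Set X) (π : X → ℂ) (F F₀ : C(Literature.Topology.FourManifolds.ComplexProjectiveSpace 1, X)), ContMDiff 𝓘(ℝ, ℂ) (𝓡 4) ∞ u → ContMDiff 𝓘(ℝ, ℂ) (𝓡 4) ∞ v → (∀ z : ℂ, z ≠ 0 → v z = u z⁻¹) → Function.Injective u → v 0 ∉ Set.range u → (∀ p, Literature.Topology.FourManifolds.ComplexProjectiveSpace.CoordNeZero 0 p → F p = u (Literature.Topology.FourManifolds.ComplexProjectiveSpace.affineCoordComplex 0 p 0)) → (∀ p, Literature.Topology.FourManifolds.ComplexProjectiveSpace.CoordNeZero 1 p → F p = v (Literature.Topology.FourManifolds.ComplexProjectiveSpace.affineCoordComplex 1 p 0)) → ContMDiff 𝓘(ℝ, ℂ) (𝓡 4) ∞ u₀ →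 ContMDiff 𝓘(ℝ, ℂ) (𝓡 4) ∞ v₀ → (∀ z : ℂ, z ≠ 0 → v₀ z = u₀ z⁻¹) → Function.Injective u₀ → (∀ z, Function.Injective (mfderiv 𝓘(ℝ, ℂ) (𝓡 4) u₀ z)) → Function.Injective (mfderiv 𝓘(ℝ, ℂ) (𝓡 4) v₀ 0) → v₀ 0 ∉ Set.range u₀ → IsOpen N → Set.range u₀ ∪ {v₀ 0} ⊆ N → ContMDiffOn (𝓡 4) 𝓘(ℝ, ℂ) ∞ π N → (∀ y ∈ N, Function.Surjective (mfderiv (𝓡 4) 𝓘(ℝ, ℂ) π y)) → {y | y ∈ N ∧ π y = 0} = Set.range u₀ ∪ {v₀ 0} → (∀ p, Literature.Topology.FourManifolds.ComplexProjectiveSpace.CoordNeZero 0 p → F₀ p = u₀ (Literature.Topology.FourManifolds.ComplexProjectiveSpace.affineCoordComplex 0 p 0)) → (∀ p, Literature.Topology.FourManifolds.ComplexProjectiveSpace.CoordNeZero 1 p → F₀ p = v₀ (Literature.Topology.FourManifolds.ComplexProjectiveSpace.affineCoordComplex 1 p 0)) → F.Homotopic F₀ → ∃ (UK : Set X) (g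 : X → ℂ) (ι : Literature.Topology.FourManifolds.ComplexProjectiveSpace 1 × ℂ → X) (s : ℂ) (A : (Fin 2 → ℂ) ≃ₗ[ℂ] (Fin 2 → ℂ)) (G : C(Literature.Topology.FourManifolds.ComplexProjectiveSpace 1, X)), IsOpen UK ∧ UK ⊆ N ∧ ContMDiffOn (𝓡 4) 𝓘(ℝ, ℂ) ∞ g UK ∧ (∀ y ∈ UK, Function.Surjective (mfderiv (𝓡 4) 𝓘(ℝ, ℂ) g y)) ∧ ContMDiff ((𝓡 2).prod 𝓘(ℝ, ℂ)) (𝓡 4) ∞ ι ∧ Function.Injective ι ∧ (∀ q, Function.Injective (mfderiv ((𝓡 2).prod 𝓘(ℝ, ℂ)) (𝓡 4) ι q)) ∧ Set.range ι = UK ∧ (∀ q, g (ι q) = q.2) ∧ (∀ θ, G θ = ι (Literature.Geometry.Symplectic.PlusOneSpherePair.projectiveMap A θ, s)) ∧ G.Homotopic F ∧ G (Literature.Topology.FourManifolds.CodimTwoData.linePt 1 0) ∉ Set.range u ∪ {v 0} ∧ ¬ (v 0 ∈ UK ∧ g (v 0) = s) ∧ (∀ z : ℂ, u z ∈ UK →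 g (u z) = s → Function.Surjective (mfderiv 𝓘(ℝ, ℂ) 𝓘(ℝ, ℂ) (fun z => g (u z)) z)) ∧ {z : ℂ | u z ∈ UK ∧ g (u z) = s}.Finite ∧ IsCompact {y | y ∈ UK ∧ g y = s} ∧ ∃ r₀ : ℝ, 0 < r₀ ∧ ∀ r : ℝ, 0 < r → r ≤ r₀ → ∑ᶠ z ∈ {z : ℂ | u z ∈ UK ∧ g (u z) = s}, Literature.Topology.PlaneTopology.wind (fun t => g (u (Literature.Topology.PlaneTopology.circleLoop z r t)) - s) = 0 := by
  intro X _ _ _ _ _ u v u₀ v₀ N π F F₀ hu hv huv _ _ hF0 hF1 hu₀ hv₀ huv₀ hinj₀ hdu₀ hdv₀ hinf₀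
    hN hSN hπ hdπ hzero hF₀0 hF₀1 hhom
  -- (1) the product neighbourhood `UK = ι (ℂℙ¹ × ℂ)` of `S₀` with its submersion `g`
  obtain ⟨UK, g, ι, hUo, -, hUN, hgs, hdg, hgzero, -, hιs, hιinj, hιd, hιrange, hι0, hιg⟩ :=
    helper_productNbhd X u₀ v₀ N π F₀ hu₀ hv₀ huv₀ hinj₀ hdu₀ hdv₀ hinf₀ hN hSN hπ hdπ hzero
      hF₀0 hF₀1
  have hιc : Continuous ι := hιs.continuous
  -- (2) a small nonzero common regular value `s` with `s ≠ g (v 0)`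
  obtain ⟨s, -, hsA, hregu, -⟩ := helper_commonRegularValue X UK g u v {0, g (v 0)} 1 hUo hgs
    hu hv ((finite_singleton _).insert 0) one_pos
  have hs0 : s ≠ 0 := fun h => hsA (by rw [h]; exact mem_insert _ _)
  have hv0 : ¬ (v 0 ∈ UK ∧ g (v 0) = s) := fun h =>
    hsA (by rw [← h.2]; exact mem_insert_of_mem _ rfl)
  -- (3) the push-off `K_s = ι (ℂℙ¹ × {s})` is compact
  have hιSc : Continuous fun θ : ComplexProjectiveSpace 1 => ι (θ, s) :=
    hιc.comp (Continuous.prodMk_left s)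
  have hKeq : {y | y ∈ UK ∧ g y = s} = range fun θ => ι (θ, s) := fibre_eq_range hιrange hιg s
  have hKc : IsCompact {y | y ∈ UK ∧ g y = s} := hKeq ▸ isCompact_range hιSc
  have hKmem : ∀ θ, ι (θ, s) ∈ UK ∧ g (ι (θ, s)) = s := fun θ =>
    ⟨hιrange ▸ mem_range_self _, hιg _⟩
  -- (4) the crossing parameters are finite
  have hfin : {z : ℂ | u z ∈ UK ∧ g (u z) = s}.Finite :=
    (helper_crossingsFinite X UK g u v s hUo hgs hu hv huv hKc hregu hv0).1
  -- (5) the signed count vanishes (the argument of `helper_homologicalCount`): the counts of the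
  -- normal coordinate `g - s` on `UK` (closed zero set `K_s`) factor through `H₂(X; ℤ)`
  have hg0 : ∀ y ∈ range u₀ ∪ {v₀ 0}, g y = 0 := fun y hy => by
    rw [← hgzero] at hy
    exact hy.2
  have hZsub : ∀ w : ℂ → X,
      {z : ℂ | w z ∈ UK ∧ g (w z) - s = 0} = {z : ℂ | w z ∈ UK ∧ g (w z) = s} := fun w => by
    ext z
    simp only [mem_setOf_eq, sub_eq_zero]
  have hKs : IsClosed {y : X | y ∈ UK ∧ (fun y => g y - s) y = 0} := by
    have e : {y : X | y ∈ UK ∧ (fun y => g y - s) y = 0} = {y | y ∈ UK ∧ g y = s} := by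
      ext y
      simp only [mem_setOf_eq, sub_eq_zero]
    rw [e]
    exact hKc.isClosed
  obtain ⟨c, hc⟩ := sphere_zeroSetIndex_factorsThroughHomology_of_isClosed X (fun y => g y - s)
    UK hUo (hgs.sub contMDiffOn_const) hKs
  -- `S₀ ⊆ {g = 0}` misses `K_s`: both index sets of `(u₀, v₀, F₀)` are empty, `c (F₀_*[ℂℙ¹]) = 0`
  have hZ₀ : {z : ℂ | u₀ z ∈ UK ∧ g (u₀ z) - s = 0} = ∅ := by
    ext z
    simp only [mem_setOf_eq, sub_eq_zero, mem_empty_iff_false, iff_false, not_and]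
    exact fun _ h => hs0 (h.symm.trans (hg0 _ (Or.inl (mem_range_self z))))
  have hZi₀ : {w : ℂ | w = 0 ∧ v₀ w ∈ UK ∧ g (v₀ w) - s = 0} = ∅ := by
    ext w
    simp only [mem_setOf_eq, sub_eq_zero, mem_empty_iff_false, iff_false, not_and]
    rintro rfl - h
    exact hs0 (h.symm.trans (hg0 _ (Or.inr rfl)))
  have hfin₀ : {z : ℂ | u₀ z ∈ UK ∧ g (u₀ z) - s = 0}.Finite := by
    rw [hZ₀]
    exact finite_empty
  obtain ⟨r₁, hr₁, H₁⟩ := hc u₀ v₀ F₀ hu₀ hv₀ huv₀ hF₀0 hF₀1 hfin₀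
  have hc₀ : c (singularHomology.map ℤ ℤ F₀ (2 * 1)
      (ComplexProjectiveSpace.homologicalOrientationInt 1).fundamentalClass) = 0 := by
    have e₁ : (∑ᶠ z ∈ {z : ℂ | u₀ z ∈ UK ∧ g (u₀ z) - s = 0},
        wind (fun t => g (u₀ (circleLoop z r₁ t)) - s)) = 0 := by
      rw [hZ₀]
      exact finsum_mem_empty
    have e₂ : (∑ᶠ w ∈ {w : ℂ | w = 0 ∧ v₀ w ∈ UK ∧ g (v₀ w) - s = 0},
        wind (fun t => g (v₀ (circleLoop w r₁ t)) - s)) = 0 := by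
      rw [hZi₀]
      exact finsum_mem_empty
    rw [H₁ r₁ hr₁ le_rfl]
    exact (congrArg₂ (· + ·) e₁ e₂).trans (add_zero 0)
  -- homotopy invariance `F_*[ℂℙ¹] = F₀_*[ℂℙ¹]`, and no crossing of `(u, v)` at infinity
  have hmap : singularHomology.map ℤ ℤ F (2 * 1) = singularHomology.map ℤ ℤ F₀ (2 * 1) :=
    singularHomology.map_eq_of_homotopic ℤ ℤ hhom (2 * 1)
  have hZi : {w : ℂ | w = 0 ∧ v w ∈ UK ∧ g (v w) - s = 0} = ∅ := by
    ext w
    simp only [mem_setOf_eq, sub_eq_zero, mem_empty_iff_false, iff_false, not_and]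
    rintro rfl hU h
    exact hv0 ⟨hU, h⟩
  have hfin' : {z : ℂ | u z ∈ UK ∧ g (u z) - s = 0}.Finite := by
    rw [hZsub]
    exact hfin
  obtain ⟨r₀, hr₀, H₂⟩ := hc u v F hu hv huv hF0 hF1 hfin'
  have hcount : ∀ r : ℝ, 0 < r → r ≤ r₀ → ∑ᶠ z ∈ {z : ℂ | u z ∈ UK ∧ g (u z) = s},
      wind (fun t => g (u (circleLoop z r t)) - s) = 0 := fun r hr hrr => by
    have e₂ : (∑ᶠ w ∈ {w : ℂ | w = 0 ∧ v w ∈ UK ∧ g (v w) - s = 0},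
        wind (fun t => g (v (circleLoop w r t)) - s)) = 0 := by
      rw [hZi]
      exact finsum_mem_empty
    rw [← hZsub u]
    calc (∑ᶠ z ∈ {z : ℂ | u z ∈ UK ∧ g (u z) - s = 0}, wind (fun t => g (u (circleLoop z r t)) - s))
        = (∑ᶠ z ∈ {z : ℂ | u z ∈ UK ∧ g (u z) - s = 0},
            wind (fun t => g (u (circleLoop z r t)) - s)) +
          (∑ᶠ w ∈ {w : ℂ | w = 0 ∧ v w ∈ UK ∧ g (v w) - s = 0},
            wind (fun t => g (v (circleLoop w r t)) - s)) := by rw [e₂, add_zero]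
      _ = c (singularHomology.map ℤ ℤ F (2 * 1)
            (ComplexProjectiveSpace.homologicalOrientationInt 1).fundamentalClass) :=
          (H₂ r hr hrr).symm
      _ = 0 := by rw [hmap, hc₀]
  -- (6) the crossings of `K_s` with the first sphere are finite; move the north pole off them
  have hCfin : {θ : ComplexProjectiveSpace 1 | ι (θ, s) ∈ range u ∪ {v 0}}.Finite := by
    have hpre : ((fun θ : ComplexProjectiveSpace 1 => ι (θ, s)) ⁻¹'
        (u '' {z : ℂ | u z ∈ UK ∧ g (u z) = s})).Finite :=
      (hfin.image u).preimage fun θ₁ _ θ₂ _ h => congrArg Prod.fst (hιinj h)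
    refine hpre.subset fun θ hθ => ?_
    rcases hθ with ⟨z, hz⟩ | hθ
    · exact ⟨z, ⟨by rw [hz]; exact (hKmem θ).1, by rw [hz]; exact (hKmem θ).2⟩, hz⟩
    · have e : ι (θ, s) = v 0 := mem_singleton_iff.1 hθ
      exact absurd ⟨e ▸ (hKmem θ).1, e ▸ (hKmem θ).2⟩ hv0
  haveI := infinite_projectiveLine
  obtain ⟨θ₁, hθ₁⟩ := hCfin.exists_notMem
  obtain ⟨A, hA⟩ := helper_moebiusTransitive θ₁
  -- (7) the reparametrised push-off sphere `G = ι (projectiveMap A ·, s) ≃ ι (·, s) ≃ F₀ ≃ F`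
  obtain ⟨ιS, hιS⟩ : ∃ ιS : C(ComplexProjectiveSpace 1, X), ∀ θ, ιS θ = ι (θ, s) :=
    ⟨⟨_, hιSc⟩, fun _ => rfl⟩
  have h1 : (ιS.comp ⟨PlusOneSpherePair.projectiveMap A,
      PlusOneSpherePair.continuous_projectiveMap A⟩).Homotopic ιS := by
    have h := (ContinuousMap.Homotopic.refl ιS).comp (helper_moebiusHomotopic A)
    rwa [ContinuousMap.comp_id] at h
  have h2 : ιS.Homotopic F₀ := homotopic_pushoff_core hιc s ιS F₀ hιS hι0
  refine ⟨UK, g, ι, s, A, ιS.comp ⟨PlusOneSpherePair.projectiveMap A,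
    PlusOneSpherePair.continuous_projectiveMap A⟩, hUo, hUN, hgs, hdg, hιs, hιinj, hιd, hιrange,
    hιg, fun θ => hιS _, (h1.trans h2).trans hhom.symm, ?_, hv0, hregu, hfin, hKc, r₀, hr₀,
    hcount⟩
  -- the north pole `[0 : 1] = linePt 1 0` of `G` is `ι (θ₁, s)`, not a crossing
  show ιS (PlusOneSpherePair.projectiveMap A (linePt 1 0)) ∉ range u ∪ {v 0}
  rw [hA, hιS]
  exact hθ₁

end Summit.SmoothPoincare4.SmoothPoincare4.Theorems.GromovRecognitionRelEnd.CrossCapLaurent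

end
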